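import Mathlib
import Summits.CriticalPhenomena.CardyFormulaZ2.Theorems.CardySelfRefinementDefs
import Summits.CriticalPhenomena.CardyFormulaZ2.Theorems.CardySelfRefinementGradientComparabilityStubCornerWindowsPatterns
import HarnessLib

/-!
# Crux `GradientComparability` (stmt-CriticalPhenomena-10269), line `monotone-product-coordinates` —
# support for stub `stub_cornerWindows`, part 3: `∂ρP = ½·N_piv − Defect` summed over the window
# (canonical enumeration of a bundle), and the two windows FROM pivotal windows + defect bounds

Route `CardySelfRefinement`, sub-problem `CriticalPhenomena/CardyFormulaZ2`; vocabulary from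
`CardySelfRefinementDefs` (`ax tb cfg prm M Aloc window coinWindow edgeOf Dρ`); the pattern formula of a
single selector from part 2 (`selectorInfl_eq_half_pivotal_sub_defect`, `coe_bundleFinset_eq_image`).

## Mathematics

The sub-edges of the bundle `(t, d)` (coarse base `t`, direction `d`) are `edgeOf (w j, d)` with the
CANONICAL base vertices `w j = k•t + j e_d`, `j < k` (`bundle_param_canonical`: axial, coarse base `t`,
exhaustive, injective — the witness of `exists_bundle_param` made explicit, so that pattern sums can
be written in closed form).  Summing the defect form of the selector influence over the selector coins
of the window (`stub_Drho_eq_signed_sum`) gives the registered sub-goal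
`Drho_eq_sum_half_pivotal_sub_defect`: for `0 < k`, `η ≠ 0`, `ρ ∈ [0,1]` (the corner `ρ = 1`
included), any `c`,

`∂ρP(ρ,c) = Σ_{bundles B of the window} ( ½ M(B set-pivotal) − 2^{-k} Σ_{J ⊆ [k]} M(A_B^J ∖ A_B^∅) )`,

`M = M_k(ρ,c)`, `A_B^J = {ω | (ω ∖ B) ∪ {e_j | j ∈ J} ∈ Aloc}`: the EXACT dictionary
"`∂ρP = (½ − 2^{-k})·(number of pivotal bundles) − (defect of the proper patterns)`" behind both Kesten
windows of `stub_cornerWindows` (on `{c = 0}` the bulk defect vanishes — partial patterns dangle —, on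
`{ρ = 1}` it is `O(c²)` of the four-arm mass), cf. the blueprint `cornerWindows_blueprint.md`.

Finally the **assembly** (`cornerWindow_c0_of_pivotalWindow_of_defectBound`,
`cornerWindow_rho1_of_pivotalWindow_of_defectBound`, both registered): the two conjuncts `h0`, `h1` of the
registered signature of `stub_cornerWindows` FOLLOW from four statements on these explicit quantities —
(K0)/(K1): on the slice `c = 0` / `ρ = 1` the pivotal count `N = Σ_B M(B set-pivotal)` of every band point
is comparable to `N` at the corner `(1,0)` (Kesten's near-critical stability: for `c = 0` coarse Bernoulli
percolation in `M_k` clothing — the tree's unproved `Kesten1987_zdFourArmStability` /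
`Kesten1987_zdPivotalCount_sameParam` are its square-crossing core —, for `ρ = 1` the enhancement family,
a new statement provable by the printed method, Nolin 2008 Thm 27 / Kesten 1987 Lemma 8);
(D0)/(D1): the defect is small, `2^{-k} Σ_B Σ_J M(A^J ∖ A^∅) ≤ θ N` with `θ < ½`, at the band points and at
the corner.  Then `(½ − θ)N ≤ |∂ρP| ≤ ½N` pointwise (`pivotal_bounds_of_defect_le`, using
`abs_Drho_le_sum_bundlePivotal`) and the windows follow with constant `C/(1 − 2θ)`
(`abs_comparable_of_pivotal_bounds`).  Pure bookkeeping; no percolation estimate is used.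
-/

noncomputable section

namespace Summit.CriticalPhenomena.CardyFormulaZ2.Theorems.CardySelfRefinement

open scoped Topology
open Filter Set MeasureTheory
open Literature.Probability.LatticeModels Literature.Probability.Percolation
open Literature.Probability.Percolation.QuadCrossing
open Summit.CriticalPhenomena.CardyFormulaZ2.Theses.CardySelfRefinement

-- adapted from `exists_bundle_param` (…Theorems/CardySelfRefinementGradientComparabilityStubSlopeBoundsBundle.lean)
/-- **The canonical enumeration of a bundle.**  For `0 < k`, the base vertices
`w j = k•t + j e_d` (`j < k`) of the sub-edges of the bundle `(t, d)` are axial with coarse base `t`,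
exhaust the axial labels `(v, d)` of coarse base `t`, and are pairwise distinct. -/
theorem bundle_param_canonical {k : ℕ} (hk : 0 < k) (t : Site 2) (d : Fin 2) :
    (∀ j, j < k → ax k ((fun l => (k : ℤ) * t l + if l = d then (j : ℤ) else 0), d) ∧
      tb k ((fun l => (k : ℤ) * t l + if l = d then (j : ℤ) else 0), d) = t) ∧
    (∀ v : Site 2, ax k (v, d) → tb k (v, d) = t →
      ∃ j, j < k ∧ v = fun l => (k : ℤ) * t l + if l = d then (j : ℤ) else 0) ∧
    (∀ j j', j < k → j' < k →
      ((fun l => (k : ℤ) * t l + if l = d then (j : ℤ) else 0) : Site 2) =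
        (fun l => (k : ℤ) * t l + if l = d then (j' : ℤ) else 0) → j = j') := by
  have hk0 : (k : ℤ) ≠ 0 := by exact_mod_cast hk.ne'
  have hkpos : (0 : ℤ) < k := by exact_mod_cast hk
  have hperp : (if d = 0 then (1 : Fin 2) else 0) ≠ d := by
    fin_cases d <;> decide
  refine ⟨?_, ?_, ?_⟩
  · intro j hj
    refine ⟨?_, ?_⟩
    · show (k : ℤ) ∣ (k : ℤ) * t _ + if (if d = 0 then (1 : Fin 2) else 0) = d then (j : ℤ) else 0
      rw [if_neg hperp, add_zero]
      exact dvd_mul_right _ _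
    · funext l
      show ((k : ℤ) * t l + if l = d then (j : ℤ) else 0) / (k : ℤ) = t l
      split_ifs
      · rw [add_comm, Int.add_mul_ediv_left _ _ hk0,
          Int.ediv_eq_zero_of_lt (by positivity) (by exact_mod_cast hj), zero_add]
      · rw [add_zero, Int.mul_ediv_cancel_left _ hk0]
  · intro v hax htb
    have hax' : (k : ℤ) ∣ v (if d = 0 then (1 : Fin 2) else 0) := hax
    have htl : ∀ l, t l = v l / k := fun l => (congrFun htb l).symm
    have h0 : 0 ≤ v d % k := Int.emod_nonneg _ hk0
    have h1 : v d % k < k := Int.emod_lt_of_pos _ hkpos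
    refine ⟨(v d % k).toNat, by omega, ?_⟩
    funext l
    show v l = (k : ℤ) * t l + if l = d then (((v d % k).toNat : ℕ) : ℤ) else 0
    by_cases hl : l = d
    · subst hl
      rw [if_pos rfl, Int.toNat_of_nonneg h0, htl]
      exact (Int.mul_ediv_add_emod _ _).symm
    · have hl' : l = (if d = 0 then (1 : Fin 2) else 0) := by
        fin_cases d <;> fin_cases l <;> simp_all
      rw [if_neg hl, add_zero, htl, hl']
      exact (Int.mul_ediv_cancel' hax').symm
  · intro j j' _ _ h
    simpa using congrFun h d

/-- **`∂ρP = Σ_bundles (½ M(bundle set-pivotal) − 2^{-k} Σ_J M(A^J ∖ A^∅))`** (registered sub-goal of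
`stub_cornerWindows`): the defect form of the selector influence summed over the selector coins
`(t,d,2)` of the coin window, the bundle of `(t,d)` being the axial edges of direction `d` and coarse base
`t` and its patterns `J ⊆ [k]` read through the canonical enumeration `e_j = edgeOf (k•t + j e_d, d)`.
Valid for `0 < k`, `η ≠ 0`, every `ρ ∈ [0,1]` (one-sided derivative at `ρ = 1`) and every `c`. -/
theorem Drho_eq_sum_half_pivotal_sub_defect : ∀ (k m : ℕ), 0 < k → ∀ (F : Fin m → Quad (Set.univ : Set ℂ)) {η : ℝ}, η ≠ 0 → ∀ {ρ : ℝ}, ρ ∈ Set.Icc (0 : ℝ) 1 → ∀ (c : ℝ) (K : Finset (Site 2 × Fin 2 × Fin 3)), (↑K : Set (Site 2 × Fin 2 × Fin 3)) = coinWindow k (window m F η) → Dρ k m F η (ρ, c) = ∑ i ∈ K with i.2.2 = 2, (1 / 2 * (M k ρ c).real {ω | ω ∪ edgeOf '' {vd : Site 2 × Fin 2 | ax k vd ∧ tb k vd = i.1 ∧ vd.2 = i.2.1} ∈ Aloc m F η ∧ ω \ edgeOf '' {vd : Site 2 × Fin 2 | ax k vd ∧ tb k vd = i.1 ∧ vd.2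 = i.2.1} ∉ Aloc m F η} - (1 / 2) ^ k * ∑ J ∈ (Finset.range k).powerset, (M k ρ c).real ({ω | ω \ edgeOf '' {vd : Site 2 × Fin 2 | ax k vd ∧ tb k vd = i.1 ∧ vd.2 = i.2.1} ∪ ↑(J.image fun j : ℕ => edgeOf ((fun l => (k : ℤ) * i.1 l + if l = i.2.1 then (j : ℤ) else 0), i.2.1)) ∈ Aloc m F η} \ {ω | ω \ edgeOf '' {vd : Site 2 × Fin 2 | ax k vd ∧ tb k vd = i.1 ∧ vd.2 = i.2.1} ∈ Aloc m F η})) := by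
  intro k m hk F η hη ρ hρ c K hK
  classical
  rw [stub_Drho_eq_signed_sum k m F hη hρ c K hK]
  refine Finset.sum_congr rfl fun i hi => ?_
  obtain ⟨t, d, j⟩ := i
  have hj : j = 2 := (Finset.mem_filter.1 hi).2
  subst hj
  obtain ⟨hw₁, hw₂, hw₃⟩ := bundle_param_canonical hk t d
  have h := selectorInfl_eq_half_pivotal_sub_defect k m F hη
    (w := fun j l => (k : ℤ) * t l + if l = d then (j : ℤ) else 0) hw₁ hw₂ hw₃ rfl ρ c
  rw [coe_bundleFinset_eq_image k (w := fun j l => (k : ℤ) * t l + if l = d then (j : ℤ) else 0)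
    hw₁ hw₂ rfl] at h
  exact h

/-! ## `∂ρP = ½·N − 2^{-k}·T` and the assembly of the two windows from pivotal windows + defect bounds -/

/-- The summed identity with the two sums separated:
`∂ρP(ρ,c) = ½ · Σ_bundles M(bundle set-pivotal) − 2^{-k} · Σ_bundles Σ_{J ⊆ [k]} M(A^J ∖ A^∅)`. -/
theorem Drho_eq_half_sum_pivotal_sub_sum_defect : ∀ (k m : ℕ), 0 < k → ∀ (F : Fin m → Quad (Set.univ : Set ℂ)) {η : ℝ}, η ≠ 0 → ∀ {ρ : ℝ}, ρ ∈ Set.Icc (0 : ℝ) 1 → ∀ (c : ℝ) (K : Finset (Site 2 × Fin 2 × Fin 3)), (↑K : Set (Site 2 × Fin 2 × Fin 3)) = coinWindow k (window m F η) → Dρ k m F η (ρ, c) = 1 / 2 * (∑ i ∈ K with i.2.2 = 2, (M k ρ c).real {ω | ω ∪ edgeOf '' {vd : Site 2 × Fin 2 | ax k vd ∧ tb k vd = i.1 ∧ vd.2 = i.2.1} ∈ Aloc m F η ∧ ω \ edgeOf '' {vd : Site 2 × Fin 2 | ax k vd ∧ tb k vd = i.1 ∧ vd.2 = i.2.1}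 ∉ Aloc m F η}) - (1 / 2) ^ k * (∑ i ∈ K with i.2.2 = 2, ∑ J ∈ (Finset.range k).powerset, (M k ρ c).real ({ω | ω \ edgeOf '' {vd : Site 2 × Fin 2 | ax k vd ∧ tb k vd = i.1 ∧ vd.2 = i.2.1} ∪ ↑(J.image fun j : ℕ => edgeOf ((fun l => (k : ℤ) * i.1 l + if l = i.2.1 then (j : ℤ) else 0), i.2.1)) ∈ Aloc m F η} \ {ω | ω \ edgeOf '' {vd : Site 2 × Fin 2 | ax k vd ∧ tb k vd = i.1 ∧ vd.2 = i.2.1} ∈ Aloc m F η})) := by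
  intro k m hk F η hη ρ hρ c K hK
  rw [Drho_eq_sum_half_pivotal_sub_defect k m hk F hη hρ c K hK, Finset.sum_sub_distrib, Finset.mul_sum,
    Finset.mul_sum]

/-- Real-inequality core of the assembly: two-sided bounds `(½ − θ)·N ≤ |D| ≤ ½·N` at a band point and at
the corner, plus comparability of the two `N`'s, give comparability of the two `|D|`'s with the constant
`C / (1 − 2θ)`. -/
theorem abs_comparable_of_pivotal_bounds {Dq D0 Nq N0 C θ : ℝ} (hθ : θ < 1 / 2) (hC : 0 ≤ C)
    (hKq : Nq ≤ C * N0) (hK0 : N0 ≤ C * Nq)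
    (huq : |Dq| ≤ 1 / 2 * Nq) (hu0 : |D0| ≤ 1 / 2 * N0)
    (hlq : (1 / 2 - θ) * Nq ≤ |Dq|) (hl0 : (1 / 2 - θ) * N0 ≤ |D0|) :
    |Dq| ≤ C / (1 - 2 * θ) * |D0| ∧ |D0| ≤ C / (1 - 2 * θ) * |Dq| := by
  have h12 : 0 < 1 - 2 * θ := by linarith
  have hNq : N0 ≤ 2 / (1 - 2 * θ) * |D0| := by
    rw [div_mul_eq_mul_div, le_div_iff₀ h12]; linarith
  have hN0 : Nq ≤ 2 / (1 - 2 * θ) * |Dq| := by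
    rw [div_mul_eq_mul_div, le_div_iff₀ h12]; linarith
  have hpos : 0 ≤ 2 / (1 - 2 * θ) := by positivity
  constructor
  · calc |Dq| ≤ 1 / 2 * Nq := huq
      _ ≤ 1 / 2 * (C * N0) := by gcongr
      _ ≤ 1 / 2 * (C * (2 / (1 - 2 * θ) * |D0|)) := by gcongr
      _ = C / (1 - 2 * θ) * |D0| := by field_simp
  · calc |D0| ≤ 1 / 2 * N0 := hu0
      _ ≤ 1 / 2 * (C * Nq) := by gcongr
      _ ≤ 1 / 2 * (C * (2 / (1 - 2 * θ) * |Dq|)) := by gcongr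
      _ = C / (1 - 2 * θ) * |Dq| := by field_simp

/-- At one parameter point: the identity `∂ρP = ½N − 2^{-k}T`, the bound `|∂ρP| ≤ (½ − 2^{-k})N` and a defect
bound `2^{-k}T ≤ θN` give `|∂ρP| ≤ ½N` and the SIGNED lower bound `(½ − θ)N ≤ ∂ρP` (so `∂ρP > 0` as soon as
`θ < ½` and some bundle is pivotal with positive probability). -/
theorem pivotal_bounds_of_defect_le {D N T θ p : ℝ} (hp : 0 ≤ p) (hN : 0 ≤ N) (hD : D = 1 / 2 * N - p * T)
    (hu : |D| ≤ (1 / 2 - p) * N) (hT : p * T ≤ θ * N) :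
    |D| ≤ 1 / 2 * N ∧ (1 / 2 - θ) * N ≤ D := by
  constructor
  · exact hu.trans (by nlinarith)
  · rw [hD]; linarith

/-- **The window on the slice `c = 0` from its pivotal window and defect bound** (registered sub-goal of
`stub_cornerWindows`, = its first conjunct `h0`).  Hypotheses on the explicit bundle quantities of
`Drho_eq_sum_half_pivotal_sub_defect` (`N` = sum over the window bundles of `M_k(bundle set-pivotal)`, `T` = sum
over the bundles and all patterns `J ⊆ [k]` of `M_k(A^J ∖ A^∅)`): (K0) the pivotal count `N` of every band point
`(ρ, 0)` is comparable to `N` at the corner `(1,0)` (Kesten's near-critical stability for coarse Bernoulli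
percolation in `M_k` clothing); (D0) at the band points and at the corner the defect is small, `2^{-k}T ≤ θN` with
`θ < ½` (bulk partial patterns dangle, boundary bundles are few).  Conclusion: `h0` with constant `C/(1 − 2θ)`. -/
theorem cornerWindow_c0_of_pivotalWindow_of_defectBound : (∀ k : ℕ, k = 2 ∨ k = 3 → ∀ (m : ℕ) (F : Fin m → Quad (Set.univ : Set ℂ)), 0 < m → ∀ vlo vhi : ℝ, 0 < vlo → vlo < vhi → vhi < 1 → ∃ C η₁ : ℝ, 0 < η₁ ∧ ∀ η ∈ Set.Ioo 0 η₁, ∀ K : Finset (Site 2 × Fin 2 × Fin 3), (↑K : Set (Site 2 × Fin 2 × Fin 3)) = coinWindow k (window m F η) → ∀ ρ ∈ Set.Icc (0 : ℝ) 1, P k m F η ρ 0 ∈ Set.Icc vlo vhi → ∑ i ∈ K with i.2.2 = 2, (M k ρ 0).real {ω | ω ∪ edgeOf '' {vd : Site 2 × Fin 2 | ax k vd ∧ tb k vd = i.1 ∧ vd.2 = i.2.1} ∈ Aloc m F η ∧ ω \ edgeOf '' {vd : Site 2 × Fin 2 | ax k vd ∧ tb k vd = i.1 ∧ vd.2 =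 i.2.1} ∉ Aloc m F η} ≤ C * ∑ i ∈ K with i.2.2 = 2, (M k 1 0).real {ω | ω ∪ edgeOf '' {vd : Site 2 × Fin 2 | ax k vd ∧ tb k vd = i.1 ∧ vd.2 = i.2.1} ∈ Aloc m F η ∧ ω \ edgeOf '' {vd : Site 2 × Fin 2 | ax k vd ∧ tb k vd = i.1 ∧ vd.2 = i.2.1} ∉ Aloc m F η} ∧ ∑ i ∈ K with i.2.2 = 2, (M k 1 0).real {ω | ω ∪ edgeOf '' {vd : Site 2 × Fin 2 | ax k vd ∧ tb k vd = i.1 ∧ vd.2 = i.2.1} ∈ Aloc m F η ∧ ω \ edgeOf '' {vd : Site 2 × Fin 2 | ax k vd ∧ tb k vd = i.1 ∧ vd.2 = i.2.1} ∉ Aloc m F η} ≤ C * ∑ i ∈ K with i.2.2 = 2, (M k ρ 0).real {ω | ω ∪ edgeOf '' {vd : Site 2 × Fin 2 | ax k vd ∧ tb k vd = i.1 ∧ vd.2 = i.2.1} ∈ Aloc m F η ∧ ω \ edgeOf '' {vd : Site 2 × Fin 2 | ax k vd ∧ tb k vd = i.1 ∧ vd.2 = i.2.1} ∉ Aloc m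 F η}) → (∀ k : ℕ, k = 2 ∨ k = 3 → ∀ (m : ℕ) (F : Fin m → Quad (Set.univ : Set ℂ)), 0 < m → ∀ vlo vhi : ℝ, 0 < vlo → vlo < vhi → vhi < 1 → ∃ θ η₁ : ℝ, θ < 1 / 2 ∧ 0 < η₁ ∧ ∀ η ∈ Set.Ioo 0 η₁, ∀ K : Finset (Site 2 × Fin 2 × Fin 3), (↑K : Set (Site 2 × Fin 2 × Fin 3)) = coinWindow k (window m F η) → (∀ ρ ∈ Set.Icc (0 : ℝ) 1, P k m F η ρ 0 ∈ Set.Icc vlo vhi → (1 / 2) ^ k * ∑ i ∈ K with i.2.2 = 2, ∑ J ∈ (Finset.range k).powerset, (M k ρ 0).real ({ω | ω \ edgeOf '' {vd : Site 2 × Fin 2 | ax k vd ∧ tb k vd = i.1 ∧ vd.2 = i.2.1} ∪ ↑(J.image fun j : ℕ => edgeOf ((fun l => (k : ℤ) * i.1 l + if l = i.2.1 then (j : ℤ) else 0), i.2.1)) ∈ Aloc m F η} \ {ω | ω \ edgeOf '' {vd : Site 2 × Fin 2 | ax k vd ∧ tb k vd = i.1 ∧ vd.2 = i.2.1} ∈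 Aloc m F η}) ≤ θ * ∑ i ∈ K with i.2.2 = 2, (M k ρ 0).real {ω | ω ∪ edgeOf '' {vd : Site 2 × Fin 2 | ax k vd ∧ tb k vd = i.1 ∧ vd.2 = i.2.1} ∈ Aloc m F η ∧ ω \ edgeOf '' {vd : Site 2 × Fin 2 | ax k vd ∧ tb k vd = i.1 ∧ vd.2 = i.2.1} ∉ Aloc m F η}) ∧ (1 / 2) ^ k * ∑ i ∈ K with i.2.2 = 2, ∑ J ∈ (Finset.range k).powerset, (M k 1 0).real ({ω | ω \ edgeOf '' {vd : Site 2 × Fin 2 | ax k vd ∧ tb k vd = i.1 ∧ vd.2 = i.2.1} ∪ ↑(J.image fun j : ℕ => edgeOf ((fun l => (k : ℤ) * i.1 l + if l = i.2.1 then (j : ℤ) else 0), i.2.1)) ∈ Aloc m F η} \ {ω | ω \ edgeOf '' {vd : Site 2 × Fin 2 | ax k vd ∧ tb k vd = i.1 ∧ vd.2 = i.2.1} ∈ Aloc m F η}) ≤ θ * ∑ i ∈ K with i.2.2 = 2, (M k 1 0).real {ω | ω ∪ edgeOf '' {vd : Site 2 × Fin 2 | ax k vd ∧ tb k vd = i.1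 ∧ vd.2 = i.2.1} ∈ Aloc m F η ∧ ω \ edgeOf '' {vd : Site 2 × Fin 2 | ax k vd ∧ tb k vd = i.1 ∧ vd.2 = i.2.1} ∉ Aloc m F η}) → ∀ k : ℕ, k = 2 ∨ k = 3 → ∀ (m : ℕ) (F : Fin m → Quad (Set.univ : Set ℂ)), 0 < m → ∀ vlo vhi : ℝ, 0 < vlo → vlo < vhi → vhi < 1 → ∃ C η₁ : ℝ, 0 < η₁ ∧ ∀ η ∈ Set.Ioo 0 η₁, ∀ ρ ∈ Set.Icc (0 : ℝ) 1, P k m F η ρ 0 ∈ Set.Icc vlo vhi → |Dρ k m F η (ρ, 0)| ≤ C * |Dρ k m F η (1, 0)| ∧ |Dρ k m F η (1, 0)| ≤ C * |Dρ k m F η (ρ, 0)| := by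
  intro K0 D0 k hk m F hm vlo vhi hvlo hvv hvhi
  have hkpos : 0 < k := by rcases hk with rfl | rfl <;> norm_num
  obtain ⟨C, η₀, hη₀, HK⟩ := K0 k hk m F hm vlo vhi hvlo hvv hvhi
  obtain ⟨θ, η₀', hθ, hη₀', HD⟩ := D0 k hk m F hm vlo vhi hvlo hvv hvhi
  refine ⟨max C 0 / (1 - 2 * θ), min η₀ η₀', lt_min hη₀ hη₀', fun η hη ρ hρ hband => ?_⟩
  have hηne : η ≠ 0 := hη.1.ne'
  obtain ⟨K, hK⟩ := exists_coinFinset k m F hηne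
  have hη1 : η ∈ Set.Ioo 0 η₀ := ⟨hη.1, hη.2.trans_le (min_le_left _ _)⟩
  have hη2 : η ∈ Set.Ioo 0 η₀' := ⟨hη.1, hη.2.trans_le (min_le_right _ _)⟩
  obtain ⟨hKq, hK0⟩ := HK η hη1 K hK ρ hρ hband
  obtain ⟨HDq, hD0⟩ := HD η hη2 K hK
  have hDq := HDq ρ hρ hband
  have h1 : (1 : ℝ) ∈ Set.Icc (0 : ℝ) 1 := ⟨zero_le_one, le_rfl⟩
  have hp : (0 : ℝ) ≤ (1 / 2) ^ k := by positivity
  have hNq : (0 : ℝ) ≤ ∑ i ∈ K with i.2.2 = 2, (M k ρ 0).real {ω | ω ∪ edgeOf '' {vd : Site 2 × Fin 2 | ax k vd ∧ tb k vd = i.1 ∧ vd.2 = i.2.1} ∈ Aloc m F η ∧ ω \ edgeOf '' {vd : Site 2 × Fin 2 | ax k vd ∧ tb k vd = i.1 ∧ vd.2 = i.2.1} ∉ Aloc m F η} := Finset.sum_nonneg fun i _ => measureReal_nonneg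
  have hN0 : (0 : ℝ) ≤ ∑ i ∈ K with i.2.2 = 2, (M k 1 0).real {ω | ω ∪ edgeOf '' {vd : Site 2 × Fin 2 | ax k vd ∧ tb k vd = i.1 ∧ vd.2 = i.2.1} ∈ Aloc m F η ∧ ω \ edgeOf '' {vd : Site 2 × Fin 2 | ax k vd ∧ tb k vd = i.1 ∧ vd.2 = i.2.1} ∉ Aloc m F η} := Finset.sum_nonneg fun i _ => measureReal_nonneg
  obtain ⟨huq, hlq⟩ := pivotal_bounds_of_defect_le hp hNq
    (Drho_eq_half_sum_pivotal_sub_sum_defect k m hkpos F hηne hρ 0 K hK)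
    (abs_Drho_le_sum_bundlePivotal k m hkpos F hηne hρ 0 K hK) hDq
  obtain ⟨hu0, hl0⟩ := pivotal_bounds_of_defect_le hp hN0
    (Drho_eq_half_sum_pivotal_sub_sum_defect k m hkpos F hηne h1 0 K hK)
    (abs_Drho_le_sum_bundlePivotal k m hkpos F hηne h1 0 K hK) hD0
  have hC0 : C ≤ max C 0 := le_max_left _ _
  exact abs_comparable_of_pivotal_bounds hθ (le_max_right _ _)
    (hKq.trans (mul_le_mul_of_nonneg_right hC0 hN0)) (hK0.trans (mul_le_mul_of_nonneg_right hC0 hNq))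
    huq hu0 (hlq.trans (le_abs_self _)) (hl0.trans (le_abs_self _))

/-- **The window on the enhancement slice `ρ = 1` from its pivotal window and defect bound** (registered
sub-goal of `stub_cornerWindows`, = its second conjunct `h1`): (K1) the pivotal count of every band point `(1, c)`
is comparable to that of the corner (Kesten's stability for the enhancement family `c ↦ M_k(1,c)` — new statement,
printed method); (D1) the defect is small there (`O(c²)` bulk patterns, few boundary bundles).  Conclusion: `h1`
with constant `C/(1 − 2θ)`; together with `cornerWindow_c0_of_pivotalWindow_of_defectBound` this is the
registered signature of `stub_cornerWindows`, hence (`stub_cornerPatch_of_sliceWindows`) the corner patch. -/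
theorem cornerWindow_rho1_of_pivotalWindow_of_defectBound : (∀ k : ℕ, k = 2 ∨ k = 3 → ∀ (m : ℕ) (F : Fin m → Quad (Set.univ : Set ℂ)), 0 < m → ∀ vlo vhi : ℝ, 0 < vlo → vlo < vhi → vhi < 1 → ∃ C η₁ : ℝ, 0 < η₁ ∧ ∀ η ∈ Set.Ioo 0 η₁, ∀ K : Finset (Site 2 × Fin 2 × Fin 3), (↑K : Set (Site 2 × Fin 2 × Fin 3)) = coinWindow k (window m F η) → ∀ c ∈ Set.Icc (0 : ℝ) 1, P k m F η 1 c ∈ Set.Icc vlo vhi → ∑ i ∈ K with i.2.2 = 2, (M k 1 c).real {ω | ω ∪ edgeOf '' {vd : Site 2 × Fin 2 | ax k vd ∧ tb k vd = i.1 ∧ vd.2 = i.2.1} ∈ Aloc m F η ∧ ω \ edgeOf '' {vd : Site 2 × Fin 2 | ax k vd ∧ tb k vd = i.1 ∧ vd.2 = i.2.1} ∉ Aloc m F η} ≤ C * ∑ i ∈ K with i.2.2 = 2, (M k 1 0).real {ω | ω ∪ edgeOf '' {vd : Site 2 × Fin 2 | ax k vd ∧ tb k vd = i.1 ∧ vd.2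 = i.2.1} ∈ Aloc m F η ∧ ω \ edgeOf '' {vd : Site 2 × Fin 2 | ax k vd ∧ tb k vd = i.1 ∧ vd.2 = i.2.1} ∉ Aloc m F η} ∧ ∑ i ∈ K with i.2.2 = 2, (M k 1 0).real {ω | ω ∪ edgeOf '' {vd : Site 2 × Fin 2 | ax k vd ∧ tb k vd = i.1 ∧ vd.2 = i.2.1} ∈ Aloc m F η ∧ ω \ edgeOf '' {vd : Site 2 × Fin 2 | ax k vd ∧ tb k vd = i.1 ∧ vd.2 = i.2.1} ∉ Aloc m F η} ≤ C * ∑ i ∈ K with i.2.2 = 2, (M k 1 c).real {ω | ω ∪ edgeOf '' {vd : Site 2 × Fin 2 | ax k vd ∧ tb k vd = i.1 ∧ vd.2 = i.2.1} ∈ Aloc m F η ∧ ω \ edgeOf '' {vd : Site 2 × Fin 2 | ax k vd ∧ tb k vd = i.1 ∧ vd.2 = i.2.1} ∉ Aloc m F η}) → (∀ k : ℕ, k = 2 ∨ k = 3 → ∀ (m : ℕ) (F : Fin m → Quad (Set.univ : Set ℂ)), 0 < m → ∀ vlo vhi : ℝ, 0 < vlo → vlo < vhi → vhi < 1 → ∃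 θ η₁ : ℝ, θ < 1 / 2 ∧ 0 < η₁ ∧ ∀ η ∈ Set.Ioo 0 η₁, ∀ K : Finset (Site 2 × Fin 2 × Fin 3), (↑K : Set (Site 2 × Fin 2 × Fin 3)) = coinWindow k (window m F η) → (∀ c ∈ Set.Icc (0 : ℝ) 1, P k m F η 1 c ∈ Set.Icc vlo vhi → (1 / 2) ^ k * ∑ i ∈ K with i.2.2 = 2, ∑ J ∈ (Finset.range k).powerset, (M k 1 c).real ({ω | ω \ edgeOf '' {vd : Site 2 × Fin 2 | ax k vd ∧ tb k vd = i.1 ∧ vd.2 = i.2.1} ∪ ↑(J.image fun j : ℕ => edgeOf ((fun l => (k : ℤ) * i.1 l + if l = i.2.1 then (j : ℤ) else 0), i.2.1)) ∈ Aloc m F η} \ {ω | ω \ edgeOf '' {vd : Site 2 × Fin 2 | ax k vd ∧ tb k vd = i.1 ∧ vd.2 = i.2.1} ∈ Aloc m F η}) ≤ θ * ∑ i ∈ K with i.2.2 = 2, (M k 1 c).real {ω | ω ∪ edgeOf '' {vd : Site 2 × Fin 2 | ax k vd ∧ tb k vd = i.1 ∧ vd.2 = i.2.1} ∈ Aloc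 m F η ∧ ω \ edgeOf '' {vd : Site 2 × Fin 2 | ax k vd ∧ tb k vd = i.1 ∧ vd.2 = i.2.1} ∉ Aloc m F η}) ∧ (1 / 2) ^ k * ∑ i ∈ K with i.2.2 = 2, ∑ J ∈ (Finset.range k).powerset, (M k 1 0).real ({ω | ω \ edgeOf '' {vd : Site 2 × Fin 2 | ax k vd ∧ tb k vd = i.1 ∧ vd.2 = i.2.1} ∪ ↑(J.image fun j : ℕ => edgeOf ((fun l => (k : ℤ) * i.1 l + if l = i.2.1 then (j : ℤ) else 0), i.2.1)) ∈ Aloc m F η} \ {ω | ω \ edgeOf '' {vd : Site 2 × Fin 2 | ax k vd ∧ tb k vd = i.1 ∧ vd.2 = i.2.1} ∈ Aloc m F η}) ≤ θ * ∑ i ∈ K with i.2.2 = 2, (M k 1 0).real {ω | ω ∪ edgeOf '' {vd : Site 2 × Fin 2 | ax k vd ∧ tb k vd = i.1 ∧ vd.2 = i.2.1} ∈ Aloc m F η ∧ ω \ edgeOf '' {vd : Site 2 × Fin 2 | ax k vd ∧ tb k vd = i.1 ∧ vd.2 = i.2.1} ∉ Aloc m F η}) → ∀ k : ℕ, k = 2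 ∨ k = 3 → ∀ (m : ℕ) (F : Fin m → Quad (Set.univ : Set ℂ)), 0 < m → ∀ vlo vhi : ℝ, 0 < vlo → vlo < vhi → vhi < 1 → ∃ C η₁ : ℝ, 0 < η₁ ∧ ∀ η ∈ Set.Ioo 0 η₁, ∀ c ∈ Set.Icc (0 : ℝ) 1, P k m F η 1 c ∈ Set.Icc vlo vhi → |Dρ k m F η (1, c)| ≤ C * |Dρ k m F η (1, 0)| ∧ |Dρ k m F η (1, 0)| ≤ C * |Dρ k m F η (1, c)| := by
  intro K1 D1 k hk m F hm vlo vhi hvlo hvv hvhi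
  have hkpos : 0 < k := by rcases hk with rfl | rfl <;> norm_num
  obtain ⟨C, η₀, hη₀, HK⟩ := K1 k hk m F hm vlo vhi hvlo hvv hvhi
  obtain ⟨θ, η₀', hθ, hη₀', HD⟩ := D1 k hk m F hm vlo vhi hvlo hvv hvhi
  refine ⟨max C 0 / (1 - 2 * θ), min η₀ η₀', lt_min hη₀ hη₀', fun η hη c hc hband => ?_⟩
  have hηne : η ≠ 0 := hη.1.ne'
  obtain ⟨K, hK⟩ := exists_coinFinset k m F hηne
  have hη1 : η ∈ Set.Ioo 0 η₀ := ⟨hη.1, hη.2.trans_le (min_le_left _ _)⟩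
  have hη2 : η ∈ Set.Ioo 0 η₀' := ⟨hη.1, hη.2.trans_le (min_le_right _ _)⟩
  obtain ⟨hKq, hK0⟩ := HK η hη1 K hK c hc hband
  obtain ⟨HDq, hD0⟩ := HD η hη2 K hK
  have hDq := HDq c hc hband
  have h1 : (1 : ℝ) ∈ Set.Icc (0 : ℝ) 1 := ⟨zero_le_one, le_rfl⟩
  have hp : (0 : ℝ) ≤ (1 / 2) ^ k := by positivity
  have hNq : (0 : ℝ) ≤ ∑ i ∈ K with i.2.2 = 2, (M k 1 c).real {ω | ω ∪ edgeOf '' {vd : Site 2 × Fin 2 | ax k vd ∧ tb k vd = i.1 ∧ vd.2 = i.2.1} ∈ Aloc m F η ∧ ω \ edgeOf '' {vd : Site 2 × Fin 2 | ax k vd ∧ tb k vd = i.1 ∧ vd.2 = i.2.1} ∉ Aloc m F η} := Finset.sum_nonneg fun i _ => measureReal_nonneg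
  have hN0 : (0 : ℝ) ≤ ∑ i ∈ K with i.2.2 = 2, (M k 1 0).real {ω | ω ∪ edgeOf '' {vd : Site 2 × Fin 2 | ax k vd ∧ tb k vd = i.1 ∧ vd.2 = i.2.1} ∈ Aloc m F η ∧ ω \ edgeOf '' {vd : Site 2 × Fin 2 | ax k vd ∧ tb k vd = i.1 ∧ vd.2 = i.2.1} ∉ Aloc m F η} := Finset.sum_nonneg fun i _ => measureReal_nonneg
  obtain ⟨huq, hlq⟩ := pivotal_bounds_of_defect_le hp hNq
    (Drho_eq_half_sum_pivotal_sub_sum_defect k m hkpos F hηne h1 c K hK)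
    (abs_Drho_le_sum_bundlePivotal k m hkpos F hηne h1 c K hK) hDq
  obtain ⟨hu0, hl0⟩ := pivotal_bounds_of_defect_le hp hN0
    (Drho_eq_half_sum_pivotal_sub_sum_defect k m hkpos F hηne h1 0 K hK)
    (abs_Drho_le_sum_bundlePivotal k m hkpos F hηne h1 0 K hK) hD0
  have hC0 : C ≤ max C 0 := le_max_left _ _
  exact abs_comparable_of_pivotal_bounds hθ (le_max_right _ _)
    (hKq.trans (mul_le_mul_of_nonneg_right hC0 hN0)) (hK0.trans (mul_le_mul_of_nonneg_right hC0 hNq))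
    huq hu0 (hlq.trans (le_abs_self _)) (hl0.trans (le_abs_self _))

end Summit.CriticalPhenomena.CardyFormulaZ2.Theorems.CardySelfRefinement

end
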